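import Summits.Ventures.Crystal3D.Bulk.ClosePackedWitness
import HarnessLib

/-!
# Hexagonal axes of close-packed shells: definitions and the pattern lemma (W-2G, kernel part 1/2)

HONEST FRAMING. Part of the venture `Summits/Ventures/Crystal3D` (cell `pub-crystal3d`, phase 2;
mathematics and Lean text by seat theory-2 (g8); filed by seat p1 (g8) per lead g7 RULING #60 (g7),
split in two files for the tree's 400-line rule — statements and proofs are theory-2's scratch
`HOME/lean/glue/TwinJunctionWitness.lean` (sha16 `1aca1caea487ddcc`) byte for byte, docstrings added).
A NEGATIVE / scope file for the fixed theorem wording (GLUE-STATUS.md §3): it certifies nothing about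
`−0.63`, moves no number, and is not used by `BulkCrystallization3D`.

CONTENTS (generic part; the 26-ball witness is `Bulk/TwinJunctionWitness.lean`):
* `IsContactConnected x G` — `G` is connected through contacts inside `G`;
* `hcpAxisVec = (1,1,1)` — the normal of the hcp pattern's hexagonal mirror plane; `HasHexAxis x i n`
  — ball `i` has an anticuboctahedral contact shell placed by a congruence carrying the pattern axis
  to `± n`; `IsUniaxial x G` — all anticuboctahedral-shelled members of `G` share one axis `± n`;
* the PATTERN LEMMA `inner_axis_eq_zero_of_neg_mem`: under ANY congruence `A` placing the hcp pattern
  onto a shell, the image of the pattern axis is orthogonal to every shell vector whose antipode is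
  also a shell vector (kernel fact `hcpInt_sum_eq_zero_of_neg_mem`) — the hexagonal mirror plane is
  intrinsic to the shell as a SET;
* integer-model plumbing (`contactNeighbors_intConfig_eq`, `contactShell_intConfig`) and the
  coordinate reflection `x₂ ↦ −x₂` (`flipInt` on `ℤ³`, `coordFlip` on `ℝ³`, a linear isometry).
-/

noncomputable section

open scoped BigOperators InnerProductSpace
open Finset

namespace Summit.Ventures.Crystal3D

open Literature.Geometry.DiscreteGeometry (fccKissingPattern hcpKissingPattern fccInt hcpInt intVec
  intVec_apply intVec_sub intVec_injective sqNormInt scaledPattern IsArrangedIn isArrangedIn_self)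
open Literature.Barriers.AtomisticToContinuum (intConfig)

variable {N : ℕ}

/-! ## Definitions: contact-connected clusters, hexagonal axes, uni-axiality -/

/-- `G` is connected through contacts INSIDE `G`. -/
def IsContactConnected (x : Fin N → EuclideanSpace ℝ (Fin 3)) (G : Finset (Fin N)) : Prop :=
  ∀ i ∈ G, ∀ j ∈ G,
    Relation.ReflTransGen (fun a b => a ∈ G ∧ b ∈ G ∧ b ∈ contactNeighbors x a) i j

/-- The normal `(1,1,1)` of the hcp pattern's hexagonal mirror plane `x₀ + x₁ + x₂ = 0` (pattern
coordinates of `hcpKissingPattern`: six of its twelve vectors lie in that plane). -/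
def hcpAxisVec : EuclideanSpace ℝ (Fin 3) := intVec ![1, 1, 1]

/-- Ball `i` has an anticuboctahedral contact shell placed by a congruence `A` that carries the
pattern axis to `± n`. -/
def HasHexAxis (x : Fin N → EuclideanSpace ℝ (Fin 3)) (i : Fin N)
    (n : EuclideanSpace ℝ (Fin 3)) : Prop :=
  ∃ A : EuclideanSpace ℝ (Fin 3) →ₗᵢ[ℝ] EuclideanSpace ℝ (Fin 3),
    contactShell x i = (fun p => (2 : ℝ) • A p) '' (hcpKissingPattern : Set _) ∧
      (A hcpAxisVec = n ∨ A hcpAxisVec = -n)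

/-- All ANTICUBOCTAHEDRAL-shelled members of `G` have a common hexagonal axis `± n`. -/
def IsUniaxial (x : Fin N → EuclideanSpace ℝ (Fin 3)) (G : Finset (Fin N)) : Prop :=
  ∃ n : EuclideanSpace ℝ (Fin 3), ∀ i ∈ G,
    IsArrangedIn (contactShell x i) hcpKissingPattern → HasHexAxis x i n

/-! ## Small vector lemmas -/

/-- `intVec` commutes with negation. -/
theorem intVec_neg (v : Fin 3 → ℤ) : intVec (-v) = -intVec v := by
  ext i; simp [intVec]

/-- `intVec (3 • v) = 3 • intVec v`. -/
theorem intVec_three_smul (v : Fin 3 → ℤ) : intVec (3 • v) = (3 : ℝ) • intVec v := by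
  ext i; simp [intVec]

/-- Inner products against integer vectors, in coordinates. -/
theorem inner_intVec_right (n : EuclideanSpace ℝ (Fin 3)) (v : Fin 3 → ℤ) :
    ⟪n, intVec v⟫_ℝ = n 0 * v 0 + n 1 * v 1 + n 2 * v 2 := by
  rw [real_inner_comm]
  simp only [PiLp.inner_apply, Fin.sum_univ_three, intVec_apply, RCLike.inner_apply, conj_trivial]
  try ring

/-- `⟪(1,1,1), intVec v⟫ = v₀ + v₁ + v₂`. -/
theorem inner_hcpAxisVec_intVec (v : Fin 3 → ℤ) :
    ⟪hcpAxisVec, intVec v⟫_ℝ = v 0 + v 1 + v 2 := by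
  rw [hcpAxisVec, inner_intVec_right]
  simp

/-- `√18 = 3 √2`, in the form used for rescaling the fcc star `3 · fccInt`. -/
theorem sqrt_eighteen_inv_mul_three :
    (Real.sqrt ((18 : ℕ) : ℝ))⁻¹ * 3 = (Real.sqrt ((2 : ℕ) : ℝ))⁻¹ := by
  have h18 : Real.sqrt ((18 : ℕ) : ℝ) = 3 * Real.sqrt 2 := by
    rw [show ((18 : ℕ) : ℝ) = 3 ^ 2 * 2 by norm_num, Real.sqrt_mul (by norm_num),
      Real.sqrt_sq (by norm_num)]
  have h2 : Real.sqrt ((2 : ℕ) : ℝ) = Real.sqrt 2 := by norm_num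
  have hs : Real.sqrt 2 ≠ 0 := by positivity
  rw [h18, h2]
  field_simp

/-! ## The pattern lemma: the hexagonal mirror plane of the hcp pattern is intrinsic -/

/-- The vectors of `hcpInt` whose antipode is also in `hcpInt` (the hexagon) are orthogonal to
`(1,1,1)` (kernel check). -/
theorem hcpInt_sum_eq_zero_of_neg_mem : ∀ t ∈ hcpInt, -t ∈ hcpInt → t 0 + t 1 + t 2 = 0 := by
  decide

/-- **Axis orthogonality.** If a congruence `A` places the hcp pattern onto the shell `S`, then
the image of the pattern axis is orthogonal to every shell vector whose antipode is also a shell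
vector: the hexagonal mirror plane is determined by the shell as a SET. -/
theorem inner_axis_eq_zero_of_neg_mem
    {A : EuclideanSpace ℝ (Fin 3) →ₗᵢ[ℝ] EuclideanSpace ℝ (Fin 3)}
    {S : Set (EuclideanSpace ℝ (Fin 3))}
    (hS : S = (fun p => (2 : ℝ) • A p) '' (hcpKissingPattern : Set _))
    {s : EuclideanSpace ℝ (Fin 3)} (hs : s ∈ S) (hns : -s ∈ S) :
    ⟪A hcpAxisVec, s⟫_ℝ = 0 := by
  subst hS
  obtain ⟨p, hp, rfl⟩ := hs
  obtain ⟨q, hq, hq'⟩ := hns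
  have hqp : q = -p := by
    apply A.injective
    rw [map_neg]
    have h2 : (2 : ℝ) • A q = (2 : ℝ) • (-(A p)) := by rw [smul_neg]; exact hq'
    exact smul_right_injective _ (two_ne_zero) h2
  subst hqp
  rw [Finset.mem_coe, hcpKissingPattern, scaledPattern, Finset.mem_image] at hp hq
  obtain ⟨t, ht, rfl⟩ := hp
  obtain ⟨t', ht', ht'eq⟩ := hq
  have h18 : (Real.sqrt ((18 : ℕ) : ℝ))⁻¹ ≠ 0 := by positivity
  have htt : t' = -t := by
    apply intVec_injective
    rw [intVec_neg]
    rw [← smul_neg] at ht'eq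
    exact smul_right_injective _ h18 ht'eq
  subst htt
  have hsum := hcpInt_sum_eq_zero_of_neg_mem t ht ht'
  rw [inner_smul_right, LinearIsometry.inner_map_map, inner_smul_right, inner_hcpAxisVec_intVec]
  have : ((t 0 : ℝ) + t 1 + t 2) = 0 := by exact_mod_cast hsum
  rw [this]; ring

/-! ## Integer models: contact shells as kernel-decidable images -/

/-- Contact neighbours in an integer model, as the kernel-decidable filter. -/
theorem contactNeighbors_intConfig_eq (c : Fin N → Fin 3 → ℤ) {m : ℕ} (hm : 0 < m) (i : Fin N) :
    contactNeighbors (intConfig c (1 / Real.sqrt m)) i =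
      univ.filter fun j => j ≠ i ∧ sqNormInt (c i - c j) = m := by
  ext j
  rw [mem_contactNeighbors_intConfig _ hm, mem_filter]
  simp

/-- The contact shell of ball `i` in an integer model at scale `1/√m` is the doubled, rescaled
image of the INTEGER shell `{c j − c i : j touching i}`. -/
theorem contactShell_intConfig (c : Fin N → Fin 3 → ℤ) {m : ℕ} (hm : 0 < m) (i : Fin N) :
    contactShell (intConfig c (1 / Real.sqrt m)) i =
      (fun v : Fin 3 → ℤ => (2 : ℝ) • ((Real.sqrt m)⁻¹ • intVec v)) ''
        (((univ.filter fun j => j ≠ i ∧ sqNormInt (c i - c j) = m).image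
          fun j => c j - c i : Finset (Fin 3 → ℤ)) : Set (Fin 3 → ℤ)) := by
  rw [contactShell, contactNeighbors_intConfig_eq c hm i, coe_image, Set.image_image]
  refine Set.image_congr' fun j => ?_
  simp only [intConfig, one_div, ← intVec_sub, smul_sub]

/-! ## The coordinate reflection `x₂ ↦ −x₂` -/

/-- The coordinate reflection `x₂ ↦ −x₂` on integer vectors. -/
def flipInt (t : Fin 3 → ℤ) : Fin 3 → ℤ := ![t 0, t 1, -t 2]

/-- The coordinate reflection `x₂ ↦ −x₂` of `ℝ³`, a linear isometry. -/
def coordFlip : EuclideanSpace ℝ (Fin 3) ≃ₗᵢ[ℝ] EuclideanSpace ℝ (Fin 3) :=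
  LinearIsometryEquiv.piLpCongrRight 2 fun j : Fin 3 =>
    if j = 2 then LinearIsometryEquiv.neg ℝ else LinearIsometryEquiv.refl ℝ ℝ

/-- `coordFlip` negates the coordinate `x₂`. -/
theorem coordFlip_apply_two (x : EuclideanSpace ℝ (Fin 3)) : coordFlip x 2 = -x 2 := by
  simp [coordFlip, LinearIsometryEquiv.piLpCongrRight_apply]

/-- `coordFlip` fixes the coordinates `x₀`, `x₁`. -/
theorem coordFlip_apply_of_ne_two {j : Fin 3} (hj : j ≠ 2) (x : EuclideanSpace ℝ (Fin 3)) :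
    coordFlip x j = x j := by
  simp [coordFlip, LinearIsometryEquiv.piLpCongrRight_apply, hj]

/-- `coordFlip` acts on integer vectors as `flipInt`. -/
theorem coordFlip_intVec (t : Fin 3 → ℤ) : coordFlip (intVec t) = intVec (flipInt t) := by
  ext j
  fin_cases j <;> simp [coordFlip, LinearIsometryEquiv.piLpCongrRight_apply, flipInt]

/-- `coordFlip` sends the axis `(1,1,1)` to `(1,1,−1)`. -/
theorem coordFlip_hcpAxisVec : coordFlip hcpAxisVec = intVec ![1, 1, -1] := by
  rw [hcpAxisVec, coordFlip_intVec]
  rfl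

end Summit.Ventures.Crystal3D

end
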